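import Literature.AlgebraicGeometry.Frobenioids.ArithmeticFrobenioidStandard
import Literature.AlgebraicGeometry.Frobenioids.PerfectionOps
import HarnessLib

/-!
# Frobenioids I, Theorem 6.4 (i): `D` is Div-slim with respect to `Φ^pf` — transport of Div-slimness along
# the injection `Φ ↪ Φ^pf` — PROOF

Mochizuki, *The geometry of Frobenioids I: the general theory*, Kyushu J. Math. **62** (2008) 293–400,
proof of Theorem 6.4 (i), kurims text p. 115 l. 36–37: "it follows immediately that `Φ` is non-dilating, and that
`D` is Div-slim [relative to `Φ`, hence also relative to `Φ^pf`, `Φ^rlf`]"; Def. 4.5 (iv), p. 86 (Div-slim). [cite: MochizukiFrdI2008, Thm. 6.4 (i) p.115]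

PROOF-ONLY (seat abc-iut-L6-t10 gen 2, S3 sub-DAG holder; the `Φ^pf` half of row **T64i/L07** of
`HOME/staging/L1/L1-t1/gen2/S3-LEMMA-LIST.md` — the `Φ^rlf` half waits for THE realification of the arithmetic
divisor monoid, abc-iut-L1-d2's `RealificationData.canonical`, which needs "`Φ(L)` perf-factorial", T64i/L02).
PROVED:
* `PreFrobenioidData.IsDivSlim.of_injective_hom` — GENERIC transport: if `ι : Φ(X) ↪ Φ'(X)` is injective
  and compatible with pull-backs, for operations `S`, `S'` over the same base `D`, then Div-slimness of `D`
  with respect to `Φ` implies Div-slimness with respect to `Φ'` (an automorphism of `D_A → D` acting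
  trivially on `Φ'` acts trivially on `Φ`);
* `PreFrobenioid.Perfection.ops_isDivSlim_of` — for every Frobenioid `C → F_Φ` with (objectwise) divisorial
  `Φ` (so that `Φ(X) → Φ(X)^pf` is injective, §0 p. 11): Div-slim w.r.t. `Φ` ⟹ Div-slim w.r.t. the divisor
  monoid `Φ^pf` of THE perfection `C^pf` (abc-iut-L1-d9's `PreFrobenioid.Perfection.ops`);
* `arithFrobenioid_perfection_isDivSlim` — **Thm. 6.4 (i): `D = B(Gal(K/F))⁰` is Div-slim with respect to
  `Φ^pf`** for THE perfection of the constructed `C_{K/F}` (from `arithFrobenioidOps_isDivSlim`,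
  abc-iut-L6-t10 gen 0, and `arithFrobenioid_isFrobenioid`).
No definitions; nothing here bears on [IUTchIII] or asserts anything about abc.
-/

noncomputable section

namespace Literature.AlgebraicGeometry.Frobenioids

open CategoryTheory Opposite Function

/-! ### Generic transport of Div-slimness along an injective, pull-back-compatible map of divisor monoids -/

namespace PreFrobenioidData

universe w w' v v' u u' v₂ u₂

variable {C : Type u} [Category.{v} C] {C' : Type u₂} [Category.{v₂} C'] {D : Type u'} [Category.{v'} D]

/-- **Div-slimness transports along injections of divisor monoids** (the step "Div-slim [relative to `Φ`],
hence also relative to `Φ^pf`, `Φ^rlf`" of FrdI p. 115 l. 36–37): for operations `S`, `S'` over the same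
base `D` and maps `ι_X : Φ(X) → Φ'(X)` that are injective and commute with pull-backs, if an automorphism of
`D_A → D` acting trivially on `Φ` is trivial (Div-slim w.r.t. `Φ`, Def. 4.5 (iv)), then so is one acting
trivially on `Φ'`. [cite: MochizukiFrdI2008, Def. 4.5 (iv) p.86] -/
theorem IsDivSlim.of_injective_hom (S : PreFrobenioidData.{w} C D) (S' : PreFrobenioidData.{w'} C' D)
    (ι : ∀ X : D, S.Mon X → S'.Mon X) (hι : ∀ X, Injective (ι X))
    (hnat : ∀ {X Y : D} (σ : Y ⟶ X) (x : S.Mon X), S'.pull σ (ι X x) = ι Y (S.pull σ x))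
    (h : S.IsDivSlim) : S'.IsDivSlim := by
  refine ⟨fun A α hα => h.eq_one A α fun B x => hι _ ?_⟩
  rw [← hnat, hα]

end PreFrobenioidData

/-! ### Div-slim w.r.t. `Φ` ⟹ Div-slim w.r.t. `Φ^pf`, for a Frobenioid with divisorial `Φ` -/

namespace PreFrobenioid

universe w v v' u u'

variable {D : Type u} [Category.{v} D] {Φ : Dᵒᵖ ⥤ CommMonCat.{w}}
  {C : Type u'} [Category.{v'} C] {F : C ⥤ ElemFrobenioid Φ} (hF : IsFrobenioid F)

/-- For a Frobenioid `C → F_Φ` with `Φ` (objectwise) divisorial — so that `Φ(X) → Φ(X)^pf` is injective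
("if `M` is sharp, integral, and saturated", §0 p. 11) — Div-slimness of the base with respect to `Φ` implies
Div-slimness with respect to the divisor monoid `Φ^pf : X ↦ Φ(X)^pf` of THE perfection `C^pf`
(`PreFrobenioid.Perfection.ops`). [cite: MochizukiFrdI2008, Thm. 6.4 (i) p.115] -/
theorem Perfection.ops_isDivSlim_of (hΦ : Objectwise (fun M _ => IsDivisorial M) Φ)
    (h : (PreFrobenioidData.ofFunctor Φ F).IsDivSlim) : (Perfection.ops hF).IsDivSlim :=
  PreFrobenioidData.IsDivSlim.of_injective_hom (PreFrobenioidData.ofFunctor Φ F) (Perfection.ops hF)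
    (fun X => Literature.AlgebraicGeometry.Frobenioids.Perfection.of (Φ.obj (op X)))
    (fun X => of_injective_of_isSharp_isIntegral_isSaturated
      (hΦ X).isSharp (hΦ X).isPreDivisorial.isIntegral (hΦ X).isPreDivisorial.isSaturated)
    (fun _ _ => rfl) h

end PreFrobenioid

/-! ### Theorem 6.4 (i): `D = B(Gal(K/F))⁰` is Div-slim with respect to `Φ^pf` -/

section Arith

variable (F : Type) [Field F] [NumberField F] (K : Type) [Field K] [Algebra F K] [IsGalois F K]

/-- **Theorem 6.4 (i): "`D` is Div-slim [relative to `Φ`, hence also relative to `Φ^pf`, `Φ^rlf`]"** (FrdI p. 115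
l. 36–37; here the `Φ^pf` part) — PROVED for THE perfection `C_{K/F}^pf` of the constructed arithmetic Frobenioid (`C_{K/F}` is a
Frobenioid: `arithFrobenioid_isFrobenioid`; Div-slim w.r.t. `Φ`: `arithFrobenioidOps_isDivSlim`; `Φ(L)`
divisorial: `EffArithDivisor.isDivisorial`). [cite: MochizukiFrdI2008, Thm. 6.4 (i) p.115] -/
theorem arithFrobenioid_perfection_isDivSlim :
    (PreFrobenioid.Perfection.ops (arithFrobenioid_isFrobenioid F K)).IsDivSlim :=
  PreFrobenioid.Perfection.ops_isDivSlim_of _ (arithDivisorFunctor_isDivisorial F K) (by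
    have h := arithFrobenioidOps_isDivSlim F K
    rwa [show arithFrobenioidOps F K = ModelFrobenioid.data _ _ _ from ModelFrobenioid.ofModel_eq_data _ _ _] at h)

end Arith

end Literature.AlgebraicGeometry.Frobenioids

end
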